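import Literature.Probability.Process.BurkholderSubordination
import HarnessLib

/-!
# Burkholder's majorant `u_λ`: the five printed pieces, their first two derivatives along lines, and the signs (LNM 1464, §8, (8.11)–(8.13))

Probability/Process file of DEFINITIONS and THEOREMS (no named fact, no `sorry`; D-0014), first of
three files formalising the PUBLISHED concavity step of Burkholder's proof of his exponential
inequality (Thm. 8.1): "The function `G` is concave on `I`" (LNM 1464, §8, proof of (8.10)), i.e.
the concavity clause of the tree's named fact `Burkholder1991_keyFunction`
(`BurkholderSubordination.lean`).  Requested by the `pub-nsfunc` cell (laminate cap `L-CAP-B`,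
`Summits/NavierStokesRegularity/FunctionalMining/StretchingLaminateBurkholderConcave.lean`, whose
typed hypothesis `Laminate.BurkConcave` is exactly this clause in `ℝ⁶`).  Search for candidate a
priori estimates; no regularity claim.

This file is pure one-variable real analysis.  Writing `a = |x|`, `b = |y|` and, along a line
`t ↦ (x + th, y + tk)`, `xh = x·h`, `yk = y·k`, `hh = |h|²`, `kk = |k|²`:
* `Burkholder1991.f0 … f3` — the printed formulas of `u` on `D₀, …, D₃` (`u = 1` on `D₄`),
  `Burkholder1991.uR` — `u` as a function of `(a, b)` (`burkholderU lam x y = uR lam ‖x‖ ‖y‖`,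
  `burkholderU_eq_uR`), and `Burkholder1991.Region.mem` — the open regions `D₀, …, D₄`
  [cite: Burkholder1991, §8, proof of (8.1), display after (8.8)];
* `Region.slope` — `G'(0) = φ(x,y)·h + ψ(x,y)·k` on each region, (8.11) with the printed `φ, ψ`
  [cite: Burkholder1991, §8, (8.11) and the display before (8.10)];
* `Region.curv` — `G''(0)` on each region in the printed sign-ready forms: `-2αe^{-λ}(|h|²-|k|²)`
  on `D₀`, (8.13) `2αe^{|x|+|y|-λ-1}{-|x|[x'·h + y'·k]² - R}` on `D₁`,
  `-2[(λ-|y|)²+1-|x|²]^{-3}(A + B + C)` on `D₂`, `-(|h|²-|k|²)/2(λ-1)` on `D₃`, `0` on `D₄`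
  [cite: Burkholder1991, §8, (8.12)–(8.13)];
* THEOREMS: the chain rule along any `C¹` curves `A, B, XH, YK` with `A' = XH/A`, `B' = YK/B`,
  `XH' = hh`, `YK' = kk` (`Region.hasDerivAt_piece`, `Region.hasDerivAt_slope`), the signs
  `Region.curv_nonpos` ((8.12): `G''(0) ≤ 0` on `D₀ ∪ ⋯ ∪ D₄` when `|k| ≤ |h|`), the values
  `uR = piece` on each region and the continuity of the glued formulas across the common
  boundaries (`Region.piece` / `Region.slope` agreements), used by the two sequel files
  (`BurkholderMajorantRegions`, `BurkholderConcavity`).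

## References

* [Burkholder1991] D. L. Burkholder, *Explorations in martingale theory and its applications*,
  École d'Été de Probabilités de Saint-Flour XIX—1989, Lecture Notes in Math. 1464, Springer
  1991, pp. 1–66 — §8, proof of Thm. 8.1: the display after (8.8) (definition of `u` and of
  `D₀,…,D₄`), the display before (8.10) (`φ, ψ`), (8.11)–(8.13).
-/

noncomputable section

open Set Filter Topology

namespace Literature.Probability.Process

namespace Burkholder1991

/-! ## The printed pieces of `u_λ` as functions of `a = |x|`, `b = |y|` -/

/-- `u` on `D₀`: `α(1 + |y|² - |x|²)e^{-λ}`. [cite: Burkholder1991, §8, display after (8.8)] -/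
def f0 (lam a b : ℝ) : ℝ := burkholderAlpha * (1 + b ^ 2 - a ^ 2) * Real.exp (-lam)

/-- `u` on `D₁`: `2α(1 - |x|)e^{|x| + |y| - λ - 1}`. [cite: Burkholder1991, §8, display after (8.8)] -/
def f1 (lam a b : ℝ) : ℝ := 2 * burkholderAlpha * (1 - a) * Real.exp (a + b - lam - 1)

/-- `u` on `D₂`: `(1 - |x|²)/((λ - |y|)² + 1 - |x|²)`. [cite: Burkholder1991, §8, display after (8.8)] -/
def f2 (lam a b : ℝ) : ℝ := (1 - a ^ 2) / ((lam - b) ^ 2 + 1 - a ^ 2)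

/-- `u` on `D₃`: `1 - (λ² - 1 - |y|² + |x|²)/(4(λ - 1))`. [cite: Burkholder1991, §8, display after (8.8)] -/
def f3 (lam a b : ℝ) : ℝ := 1 - (lam ^ 2 - 1 - b ^ 2 + a ^ 2) / (4 * (lam - 1))

/-- Burkholder's `u_λ` as a function of `(a, b) = (|x|, |y|)` (the same case cascade as the
tree's `burkholderU`; `burkholderU_eq_uR`). [cite: Burkholder1991, §8, display after (8.8)] -/
def uR (lam a b : ℝ) : ℝ :=
  if a = 1 then (if lam ≤ b then 1 else 0)
  else if lam ^ 2 - 1 + a ^ 2 < b ^ 2 then 1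
  else if lam - 1 + a ≤ b then f3 lam a b
  else if lam - 1 - a ≤ b then f2 lam a b
  else if 1 ≤ a + b then f1 lam a b
  else f0 lam a b

/-- `burkholderU lam x y = uR lam ‖x‖ ‖y‖`. [cite: Burkholder1991, §8, display after (8.8)] -/
theorem burkholderU_eq_uR {E : Type*} [NormedAddCommGroup E] (lam : ℝ) (x y : E) :
    burkholderU lam x y = uR lam ‖x‖ ‖y‖ := by
  unfold burkholderU uR f0 f1 f2 f3
  rfl

/-! ## The regions `D₀, …, D₄` -/

/-- Index of the five regions of the proof of (8.1). [cite: Burkholder1991, §8, display after (8.8)] -/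
inductive Region
  | D0 | D1 | D2 | D3 | D4

namespace Region

/-- The open regions (in the variables `a = |x| < 1`, `b = |y|`):
`D₀ = {|x| + |y| < 1}`, `D₁ = {1 < |x| + |y| < λ - 1, 0 < |x| < 1}`,
`D₂ = {λ - 1 - |x| < |y| < λ - 1 + |x|, |x| < 1}`, `D₃ = {λ - 1 + |x| < |y| < √(λ² - 1 + |x|²)}`,
`D₄ = {|y| > √(λ² - 1 + |x|²), |x| < 1}` (square roots removed by squaring, `|y| ≥ 0`).
[cite: Burkholder1991, §8, display after (8.8)] -/
def mem (lam a b : ℝ) : Region → Prop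
  | D0 => a + b < 1 ∧ a < 1
  | D1 => 1 < a + b ∧ a + b < lam - 1 ∧ 0 < a ∧ a < 1
  | D2 => lam - 1 - a < b ∧ b < lam - 1 + a ∧ a < 1
  | D3 => lam - 1 + a < b ∧ b ^ 2 < lam ^ 2 - 1 + a ^ 2 ∧ a < 1
  | D4 => lam ^ 2 - 1 + a ^ 2 < b ^ 2 ∧ a < 1

/-- The printed formula of `u` on each region. [cite: Burkholder1991, §8, display after (8.8)] -/
def piece (lam a b : ℝ) : Region → ℝ
  | D0 => f0 lam a b
  | D1 => f1 lam a b
  | D2 => f2 lam a b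
  | D3 => f3 lam a b
  | D4 => 1

/-- `G'(0) = φ(x,y)·h + ψ(x,y)·k` on each region, with the printed `φ, ψ` ((8.11)); here
`xh = x·h`, `yk = y·k`, and `y'·k = yk/|y|`; on `D₁` the printed `-2αe^{|x|+|y|-λ-1} x·h` is
written `… (-xh)`. [cite: Burkholder1991, §8, (8.11) and the display before (8.10)] -/
def slope (lam a b xh yk : ℝ) : Region → ℝ
  | D0 => burkholderAlpha * Real.exp (-lam) * (2 * yk - 2 * xh)
  | D1 => 2 * burkholderAlpha * Real.exp (a + b - lam - 1) * (-xh + (1 - a) * yk / b)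
  | D2 => (-2 * xh * (lam - b) ^ 2 + 2 * (lam - b) * (1 - a ^ 2) * yk / b) /
      ((lam - b) ^ 2 + 1 - a ^ 2) ^ 2
  | D3 => (yk - xh) / (2 * (lam - 1))
  | D4 => 0

/-- `G''(0)` on each region in the printed forms: `-2αe^{-λ}(|h|² - |k|²)` on `D₀`; (8.13)
`2αe^{|x|+|y|-λ-1}{-|x|[x'·h + y'·k]² - R}`, `R = |h|² - |k|² + (|k|² - (y'·k)²)(|x|+|y|-1)/|y|`
on `D₁`; `-2[(λ-|y|)² + 1 - |x|²]^{-3}(A + B + C)` on `D₂` with the printed `A, B, C`;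
`-(|h|² - |k|²)/2(λ-1)` on `D₃`; `0` on `D₄` (`hh = |h|²`, `kk = |k|²`, `x'·h = xh/|x|`,
`y'·k = yk/|y|`). [cite: Burkholder1991, §8, (8.12)–(8.13)] -/
def curv (lam a b xh yk hh kk : ℝ) : Region → ℝ
  | D0 => burkholderAlpha * Real.exp (-lam) * (2 * kk - 2 * hh)
  | D1 => 2 * burkholderAlpha * Real.exp (a + b - lam - 1) *
      (-(a * (xh / a + yk / b) ^ 2) - (hh - kk + (kk - (yk / b) ^ 2) * (a + b - 1) / b))
  | D2 => -2 * ((hh - kk) * (lam - b) ^ 2 * ((lam - b) ^ 2 + 1 - a ^ 2)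
      + (((lam - b) ^ 2 - (1 - a ^ 2)) * (yk / b) + 2 * (lam - b) * xh) ^ 2
      + (lam - b) * ((lam - b) ^ 2 + 1 - a ^ 2) * (kk - (yk / b) ^ 2) * (lam - b - (1 - a ^ 2) / b))
      / ((lam - b) ^ 2 + 1 - a ^ 2) ^ 3
  | D3 => (kk - hh) / (2 * (lam - 1))
  | D4 => 0

/-! ## Elementary facts about the regions -/

/-- `(λ - 1 + a)² < λ² - 1 + a²` for `a < 1 < λ`: the curve `∂D₃ ∩ ∂D₄` lies above `∂D₂ ∩ ∂D₃`.
[cite: Burkholder1991, §8, display after (8.8)] -/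
theorem sq_boundary_lt {lam a : ℝ} (hlam : 1 < lam) (ha : a < 1) :
    (lam - 1 + a) ^ 2 < lam ^ 2 - 1 + a ^ 2 := by nlinarith

/-- Every region lies in `{a < 1}`. [cite: Burkholder1991, §8, display after (8.8)] -/
theorem lt_one_of_mem {lam a b : ℝ} : ∀ {r : Region}, r.mem lam a b → a < 1
  | D0, h => h.2
  | D1, h => h.2.2.2
  | D2, h => h.2.2
  | D3, h => h.2.2
  | D4, h => h.2

/-- On `D₁` one has `b > 0`. [cite: Burkholder1991, §8, display after (8.8)] -/
theorem pos_b_of_mem_D1 {lam a b : ℝ} (h : D1.mem lam a b) : 0 < b := by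
  simp only [mem] at h; linarith

/-- On `D₂` (with `λ > 2`) one has `b > 0`. [cite: Burkholder1991, §8, display after (8.8)] -/
theorem pos_b_of_mem_D2 {lam a b : ℝ} (hlam : 2 < lam) (h : D2.mem lam a b) : 0 < b := by
  simp only [mem] at h; linarith

/-- On `D₂`: the denominator `(λ - b)² + 1 - a²` is positive. [cite: Burkholder1991, §8] -/
theorem den_pos_of_lt_one {lam a b : ℝ} (ha0 : 0 ≤ a) (ha : a < 1) :
    0 < (lam - b) ^ 2 + 1 - a ^ 2 := by nlinarith [sq_nonneg (lam - b)]

/-! ## `uR` equals the printed piece on each region -/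

/-- On `D_i`, `u` is given by the `i`-th formula (`λ > 2`, `a, b ≥ 0`).
[cite: Burkholder1991, §8, display after (8.8)] -/
theorem uR_eq_piece {lam a b : ℝ} (hlam : 2 < lam) (ha : 0 ≤ a) (hb : 0 ≤ b) :
    ∀ {r : Region}, r.mem lam a b → uR lam a b = r.piece lam a b
  | D0, h => by
    obtain ⟨h1, h2⟩ := h
    have hb1 : b ^ 2 ≤ (1 - a) ^ 2 := pow_le_pow_left₀ hb (by linarith) 2
    have hl2 : 4 < lam ^ 2 := by nlinarith
    have hb2 : ¬ lam ^ 2 - 1 + a ^ 2 < b ^ 2 := by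
      intro hc
      nlinarith
    unfold uR piece
    rw [if_neg h2.ne, if_neg hb2, if_neg (by linarith), if_neg (by linarith), if_neg (by linarith)]
  | D1, h => by
    obtain ⟨h1, h2, h3, h4⟩ := h
    have hc : 0 < lam - 1 - a := by linarith
    have hb1 : b ^ 2 < (lam - 1 - a) ^ 2 := by nlinarith
    have hb2 : ¬ lam ^ 2 - 1 + a ^ 2 < b ^ 2 := by
      intro hc'
      nlinarith
    unfold uR piece
    rw [if_neg h4.ne, if_neg hb2, if_neg (by linarith), if_neg (by linarith), if_pos h1.le]
  | D2, h => by
    obtain ⟨h1, h2, h3⟩ := h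
    have hc : 0 < lam - 1 + a := by linarith
    have hb1 : b ^ 2 < (lam - 1 + a) ^ 2 := by nlinarith
    have hb2 : ¬ lam ^ 2 - 1 + a ^ 2 < b ^ 2 := by
      have := sq_boundary_lt (show (1:ℝ) < lam by linarith) h3
      intro hc'
      linarith
    unfold uR piece
    rw [if_neg h3.ne, if_neg hb2, if_neg (by linarith), if_pos h1.le]
  | D3, h => by
    obtain ⟨h1, h2, h3⟩ := h
    unfold uR piece
    rw [if_neg h3.ne, if_neg (not_lt.2 h2.le), if_pos h1.le]
  | D4, h => by
    obtain ⟨h1, h2⟩ := h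
    unfold uR piece
    rw [if_neg h2.ne, if_pos h1]

/-! ## Agreement of consecutive formulas on the common boundaries (continuity of `u` inside `S`) -/

/-- `2αe^{-2} = 1/2`. [cite: Burkholder1991, §8 Thm. 8.1 (`α = e²/4`)] -/
theorem two_mul_alpha_mul_exp_neg_two : 2 * burkholderAlpha * Real.exp (-2) = 1 / 2 := by
  unfold burkholderAlpha
  rw [Real.exp_neg]
  have h : Real.exp 2 ≠ 0 := (Real.exp_pos 2).ne'
  field_simp
  ring

/-- `f0 = f1` on `a + b = 1`. [cite: Burkholder1991, §8 ("the restriction of `u` to the interior of `S` is continuous")] -/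
theorem f0_eq_f1 {lam a b : ℝ} (h : a + b = 1) : f0 lam a b = f1 lam a b := by
  unfold f0 f1
  have hb : b = 1 - a := by linarith
  subst hb
  have : a + (1 - a) - lam - 1 = -lam := by ring
  rw [this]
  ring

/-- `f1 = f2` on `a + b = λ - 1` (`a < 1`). [cite: Burkholder1991, §8 (continuity of `u`)] -/
theorem f1_eq_f2 {lam a b : ℝ} (ha0 : 0 ≤ a) (h : a + b = lam - 1) :
    f1 lam a b = f2 lam a b := by
  unfold f1 f2
  have hl : lam = a + b + 1 := by linarith
  subst hl
  have e1 : a + b - (a + b + 1) - 1 = -2 := by ring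
  rw [e1]
  have e2 : (a + b + 1 - b) ^ 2 + 1 - a ^ 2 = 2 * (1 + a) := by ring
  rw [e2]
  have h2 : 2 * burkholderAlpha * (1 - a) * Real.exp (-2) = (1 - a) / 2 := by
    have := two_mul_alpha_mul_exp_neg_two
    calc 2 * burkholderAlpha * (1 - a) * Real.exp (-2)
        = (2 * burkholderAlpha * Real.exp (-2)) * (1 - a) := by ring
      _ = (1 - a) / 2 := by rw [this]; ring
  rw [h2]
  have h1a : (1 + a) ≠ 0 := (by linarith : 0 < 1 + a).ne'
  field_simp
  ring

/-- `f2 = f3` on `b = λ - 1 + a` (`a < 1`). [cite: Burkholder1991, §8 (continuity of `u`)] -/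
theorem f2_eq_f3 {lam a b : ℝ} (hlam : 1 < lam) (ha : a < 1) (h : b = lam - 1 + a) :
    f2 lam a b = f3 lam a b := by
  unfold f2 f3
  subst h
  have e2 : (lam - (lam - 1 + a)) ^ 2 + 1 - a ^ 2 = 2 * (1 - a) := by ring
  rw [e2]
  have h1 : (1 - a) ≠ 0 := (by linarith : 0 < 1 - a).ne'
  have h2 : (lam - 1) ≠ 0 := (by linarith : 0 < lam - 1).ne'
  field_simp
  ring

/-- `f3 = 1` on `b² = λ² - 1 + a²`. [cite: Burkholder1991, §8 (continuity of `u`)] -/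
theorem f3_eq_one {lam a b : ℝ} (hlam : 1 < lam) (h : b ^ 2 = lam ^ 2 - 1 + a ^ 2) :
    f3 lam a b = 1 := by
  unfold f3
  have h2 : (lam - 1) ≠ 0 := (by linarith : 0 < lam - 1).ne'
  rw [h]
  field_simp
  ring

/-- The slopes agree on `a + b = 1` (`b ≠ 0`). [cite: Burkholder1991, §8, (8.11) (continuity of `φ, ψ` off `∂D₃`)] -/
theorem slope_D0_eq_D1 {lam a b xh yk : ℝ} (hb : b ≠ 0) (h : a + b = 1) :
    D0.slope lam a b xh yk = D1.slope lam a b xh yk := by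
  simp only [slope]
  have hb' : b = 1 - a := by linarith
  have e1 : a + b - lam - 1 = -lam := by rw [hb']; ring
  rw [e1]
  have : (1 - a) * yk / b = yk := by rw [← hb']; field_simp
  rw [this]
  ring

/-- The slopes agree on `a + b = λ - 1` (`b ≠ 0`, `a < 1`). [cite: Burkholder1991, §8, (8.11)] -/
theorem slope_D1_eq_D2 {lam a b xh yk : ℝ} (hb : b ≠ 0) (ha0 : 0 ≤ a) (h : a + b = lam - 1) :
    D1.slope lam a b xh yk = D2.slope lam a b xh yk := by
  simp only [slope]
  have hl : lam = a + b + 1 := by linarith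
  subst hl
  have e1 : a + b - (a + b + 1) - 1 = -2 := by ring
  rw [e1]
  have e2 : (a + b + 1 - b) = 1 + a := by ring
  rw [e2]
  have e3 : (1 + a) ^ 2 + 1 - a ^ 2 = 2 * (1 + a) := by ring
  rw [e3]
  have hα : 2 * burkholderAlpha * Real.exp (-2) = 1 / 2 := two_mul_alpha_mul_exp_neg_two
  have h1a : (1 + a) ≠ 0 := (by linarith : 0 < 1 + a).ne'
  have key : 2 * burkholderAlpha * Real.exp (-2) * (-xh + (1 - a) * yk / b)
      = (1 / 2) * (-xh + (1 - a) * yk / b) := by rw [hα]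
  rw [key]
  field_simp
  ring

/-- On `b = λ - 1 + a` (`a ≠ 0`, `b ≠ 0`): the jump of the slope across `∂D₂ ∩ ∂D₃` is
`slope₂ - slope₃ = a(λ-2)/(2(λ-1)) · (yk/b - xh/a)` (the sign of the last factor is the direction
of crossing; this is the computation behind (8.16), case (i)). [cite: Burkholder1991, §8, (8.16)] -/
theorem slope_D2_sub_D3 {lam a b xh yk : ℝ} (hlam : 1 < lam) (ha0 : a ≠ 0) (hb : b ≠ 0)
    (ha : a < 1) (h : b = lam - 1 + a) :
    D2.slope lam a b xh yk - D3.slope lam a b xh yk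
      = a * (lam - 2) / (2 * (lam - 1)) * (yk / b - xh / a) := by
  simp only [slope]
  have e3 : (lam - b) ^ 2 + 1 - a ^ 2 = 2 * (1 - a) := by rw [h]; ring
  rw [e3]
  have e4 : lam - b = 1 - a := by rw [h]; ring
  rw [e4]
  have h1a : (1 - a) ≠ 0 := (by linarith : 0 < 1 - a).ne'
  have hl1 : (lam - 1) ≠ 0 := (by linarith : 0 < lam - 1).ne'
  rw [h]
  rw [h] at hb
  field_simp
  ring

/-- At the corner `a = 0`, `b = λ - 1` (so `xh = x·h = 0`) all three slopes `D₁, D₂, D₃`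
coincide. [cite: Burkholder1991, §8, (8.11)] -/
theorem slope_corner {lam b xh yk : ℝ} (hlam : 1 < lam) (hxh : xh = 0) (h : b = lam - 1) :
    D1.slope lam 0 b xh yk = D3.slope lam 0 b xh yk ∧
      D2.slope lam 0 b xh yk = D3.slope lam 0 b xh yk := by
  subst hxh
  simp only [slope]
  have hb : b ≠ 0 := by rw [h]; exact (by linarith : 0 < lam - 1).ne'
  have e1 : (0 : ℝ) + b - lam - 1 = -2 := by rw [h]; ring
  rw [e1]
  have e2 : lam - b = 1 := by rw [h]; ring
  rw [e2]
  have hα : 2 * burkholderAlpha * Real.exp (-2) = 1 / 2 := two_mul_alpha_mul_exp_neg_two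
  constructor
  · rw [show 2 * burkholderAlpha * Real.exp (-2) * (-0 + (1 - 0) * yk / b)
        = (1 / 2) * (-0 + (1 - 0) * yk / b) by rw [hα]]
    rw [h]
    have : (lam - 1) ≠ 0 := (by linarith : 0 < lam - 1).ne'
    field_simp
    ring
  · rw [h]
    have : (lam - 1) ≠ 0 := (by linarith : 0 < lam - 1).ne'
    field_simp
    ring

/-- The slope on `D₃` is `(d/dt)(|y+tk|² - |x+th|²)/(4(λ-1))` at `t = 0`, and the slope on `D₄`
is `0` (computation behind (8.16), case (ii)). [cite: Burkholder1991, §8, (8.16)] -/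
theorem slope_D3_eq {lam a b xh yk : ℝ} (hlam : 1 < lam) :
    D3.slope lam a b xh yk = (2 * yk - 2 * xh) / (4 * (lam - 1)) := by
  simp only [slope]
  have : (lam - 1) ≠ 0 := (by linarith : 0 < lam - 1).ne'
  field_simp
  ring

/-- The slopes are odd in the direction `(h, k)`. [cite: Burkholder1991, §8, (8.11)] -/
theorem slope_neg {lam a b xh yk : ℝ} :
    ∀ r : Region, r.slope lam a b (-xh) (-yk) = -r.slope lam a b xh yk
  | D0 => by simp only [slope]; ring
  | D1 => by simp only [slope]; ring
  | D2 => by simp only [slope]; ring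
  | D3 => by simp only [slope]; ring
  | D4 => by simp only [slope]; ring

/-! ## The chain rule along a line: first derivatives ((8.11), (8.14)) -/

section Deriv

variable {lam : ℝ} {A B XH YK : ℝ → ℝ} {hh kk s : ℝ}

/-- `D₀`: `(d/dt) α(1 + |y|² - |x|²)e^{-λ} = αe^{-λ}(2 y·k - 2 x·h)` along any curves with
`(|x|²)' = 2 x·h`, `(|y|²)' = 2 y·k`. [cite: Burkholder1991, §8, (8.11)] -/
theorem hasDerivAt_piece_D0 (hA : HasDerivAt (fun σ => A σ ^ 2) (2 * XH s) s)
    (hB : HasDerivAt (fun σ => B σ ^ 2) (2 * YK s) s) :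
    HasDerivAt (fun σ => D0.piece lam (A σ) (B σ)) (D0.slope lam (A s) (B s) (XH s) (YK s)) s := by
  simp only [piece, slope, f0]
  have h := (((hB.const_add 1).fun_sub hA).const_mul burkholderAlpha).mul_const (Real.exp (-lam))
  refine h.congr_deriv ?_
  ring

/-- `D₃`: `(d/dt)[1 - (λ²-1-|y|²+|x|²)/(4(λ-1))] = (y·k - x·h)/(2(λ-1))` (`λ > 1`).
[cite: Burkholder1991, §8, (8.11)] -/
theorem hasDerivAt_piece_D3 (hlam : 1 < lam) (hA : HasDerivAt (fun σ => A σ ^ 2) (2 * XH s) s)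
    (hB : HasDerivAt (fun σ => B σ ^ 2) (2 * YK s) s) :
    HasDerivAt (fun σ => D3.piece lam (A σ) (B σ)) (D3.slope lam (A s) (B s) (XH s) (YK s)) s := by
  simp only [piece, slope, f3]
  have h := (((hB.const_sub (lam ^ 2 - 1)).fun_add hA).div_const (4 * (lam - 1))).const_sub 1
  refine h.congr_deriv ?_
  have : (lam - 1) ≠ 0 := (by linarith : 0 < lam - 1).ne'
  field_simp
  ring

/-- `D₄`: the piece is constant. [cite: Burkholder1991, §8, (8.11)] -/
theorem hasDerivAt_piece_D4 :
    HasDerivAt (fun σ => D4.piece lam (A σ) (B σ)) (D4.slope lam (A s) (B s) (XH s) (YK s)) s := by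
  simp only [piece, slope]
  exact hasDerivAt_const s 1

/-- `D₁`: `(d/dt) 2α(1-|x|)e^{|x|+|y|-λ-1} = 2αe^{|x|+|y|-λ-1}(-x·h + (1-|x|) y'·k)` along curves
with `|x|' = x·h/|x|`, `|y|' = y·k/|y|` (`|x|, |y| ≠ 0`). [cite: Burkholder1991, §8, (8.11)] -/
theorem hasDerivAt_piece_D1 (hA : HasDerivAt A (XH s / A s) s) (hB : HasDerivAt B (YK s / B s) s)
    (hA0 : A s ≠ 0) (hB0 : B s ≠ 0) :
    HasDerivAt (fun σ => D1.piece lam (A σ) (B σ)) (D1.slope lam (A s) (B s) (XH s) (YK s)) s := by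
  simp only [piece, slope, f1]
  have he := (((hA.fun_add hB).sub_const lam).sub_const 1).exp
  have h := ((hA.const_sub 1).const_mul (2 * burkholderAlpha)).fun_mul he
  refine h.congr_deriv ?_
  field_simp
  ring

/-- `D₂`: `(d/dt) (1-|x|²)/((λ-|y|)²+1-|x|²) = [-2 x·h (λ-|y|)² + 2(λ-|y|)(1-|x|²) y'·k]/[…]²`
along curves with `(|x|²)' = 2 x·h`, `|y|' = y·k/|y|` (`|y| ≠ 0`, denominator `≠ 0`).
[cite: Burkholder1991, §8, (8.11)] -/
theorem hasDerivAt_piece_D2 (hA : HasDerivAt (fun σ => A σ ^ 2) (2 * XH s) s)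
    (hB : HasDerivAt B (YK s / B s) s) (hB0 : B s ≠ 0)
    (hD : (lam - B s) ^ 2 + 1 - A s ^ 2 ≠ 0) :
    HasDerivAt (fun σ => D2.piece lam (A σ) (B σ)) (D2.slope lam (A s) (B s) (XH s) (YK s)) s := by
  simp only [piece, slope, f2]
  have hlb := hB.const_sub lam
  have hden := ((hlb.fun_pow 2).add_const 1).fun_sub hA
  have h := (hA.const_sub 1).fun_div hden hD
  refine h.congr_deriv ?_
  norm_num
  field_simp
  ring

/-! ## The chain rule along a line: second derivatives ((8.12)–(8.13), (8.15)) -/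

/-- `D₀`: `G'' = αe^{-λ}(2|k|² - 2|h|²)`. [cite: Burkholder1991, §8, (8.12)] -/
theorem hasDerivAt_slope_D0 (hXH : HasDerivAt XH hh s) (hYK : HasDerivAt YK kk s) :
    HasDerivAt (fun σ => D0.slope lam (A σ) (B σ) (XH σ) (YK σ))
      (D0.curv lam (A s) (B s) (XH s) (YK s) hh kk) s := by
  simp only [slope, curv]
  exact ((hYK.const_mul 2).fun_sub (hXH.const_mul 2)).const_mul (burkholderAlpha * Real.exp (-lam))

/-- `D₃`: `G'' = (|k|² - |h|²)/(2(λ-1))`. [cite: Burkholder1991, §8, (8.12)] -/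
theorem hasDerivAt_slope_D3 (hXH : HasDerivAt XH hh s) (hYK : HasDerivAt YK kk s) :
    HasDerivAt (fun σ => D3.slope lam (A σ) (B σ) (XH σ) (YK σ))
      (D3.curv lam (A s) (B s) (XH s) (YK s) hh kk) s := by
  simp only [slope, curv]
  exact (hYK.fun_sub hXH).div_const (2 * (lam - 1))

/-- `D₄`: `G'' = 0`. [cite: Burkholder1991, §8, (8.12)] -/
theorem hasDerivAt_slope_D4 :
    HasDerivAt (fun σ => D4.slope lam (A σ) (B σ) (XH σ) (YK σ))
      (D4.curv lam (A s) (B s) (XH s) (YK s) hh kk) s := by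
  simp only [slope, curv]
  exact hasDerivAt_const s 0

/-- `D₁`: (8.13), `G'' = 2αe^{|x|+|y|-λ-1}{-|x|[x'·h + y'·k]² - R}` along curves with
`|x|' = x·h/|x|`, `|y|' = y·k/|y|`, `(x·h)' = |h|²`, `(y·k)' = |k|²`. [cite: Burkholder1991, §8, (8.13)] -/
theorem hasDerivAt_slope_D1 (hA : HasDerivAt A (XH s / A s) s) (hB : HasDerivAt B (YK s / B s) s)
    (hXH : HasDerivAt XH hh s) (hYK : HasDerivAt YK kk s) (hA0 : A s ≠ 0) (hB0 : B s ≠ 0) :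
    HasDerivAt (fun σ => D1.slope lam (A σ) (B σ) (XH σ) (YK σ))
      (D1.curv lam (A s) (B s) (XH s) (YK s) hh kk) s := by
  simp only [slope, curv]
  have he := ((((hA.fun_add hB).sub_const lam).sub_const 1).exp).const_mul (2 * burkholderAlpha)
  have hin := hXH.fun_neg.fun_add (((hA.const_sub 1).fun_mul hYK).fun_div hB hB0)
  have h := he.fun_mul hin
  refine h.congr_deriv ?_
  field_simp
  ring

/-- `D₂`: `G'' = -2[(λ-|y|)²+1-|x|²]^{-3}(A + B + C)` with the printed `A, B, C`, along curves with
`(|x|²)' = 2 x·h`, `|y|' = y·k/|y|`, `(x·h)' = |h|²`, `(y·k)' = |k|²`.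
[cite: Burkholder1991, §8, (8.13) (display for `D₂`)] -/
theorem hasDerivAt_slope_D2 (hA : HasDerivAt (fun σ => A σ ^ 2) (2 * XH s) s)
    (hB : HasDerivAt B (YK s / B s) s) (hXH : HasDerivAt XH hh s) (hYK : HasDerivAt YK kk s)
    (hB0 : B s ≠ 0) (hD : (lam - B s) ^ 2 + 1 - A s ^ 2 ≠ 0) :
    HasDerivAt (fun σ => D2.slope lam (A σ) (B σ) (XH σ) (YK σ))
      (D2.curv lam (A s) (B s) (XH s) (YK s) hh kk) s := by
  simp only [slope, curv]
  have hlb := hB.const_sub lam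
  have t1 := (hXH.const_mul (-2)).fun_mul (hlb.fun_pow 2)
  have t2 := (((hlb.const_mul 2).fun_mul (hA.const_sub 1)).fun_mul hYK).fun_div hB hB0
  have hnum := t1.fun_add t2
  have hden := (((hlb.fun_pow 2).add_const 1).fun_sub hA).fun_pow 2
  have h := hnum.fun_div hden (pow_ne_zero 2 hD)
  refine h.congr_deriv ?_
  norm_num
  field_simp
  ring

end Deriv

/-! ## Signs of the second derivatives ((8.12)) -/

/-- (8.12) on `D₀`: `G'' ≤ 0` when `|k| ≤ |h|`. [cite: Burkholder1991, §8, (8.12)] -/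
theorem curv_nonpos_D0 {lam a b xh yk hh kk : ℝ} (hk : kk ≤ hh) :
    D0.curv lam a b xh yk hh kk ≤ 0 := by
  simp only [curv]
  have : 0 < burkholderAlpha * Real.exp (-lam) := mul_pos burkholderAlpha_pos (Real.exp_pos _)
  nlinarith

/-- (8.12) on `D₃`: `G'' ≤ 0` when `|k| ≤ |h|` (`λ > 1`). [cite: Burkholder1991, §8, (8.12)] -/
theorem curv_nonpos_D3 {lam a b xh yk hh kk : ℝ} (hlam : 1 < lam) (hk : kk ≤ hh) :
    D3.curv lam a b xh yk hh kk ≤ 0 := by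
  simp only [curv]
  exact div_nonpos_of_nonpos_of_nonneg (by linarith) (by linarith)

/-- (8.12) on `D₄`: `G'' = 0`. [cite: Burkholder1991, §8, (8.12)] -/
theorem curv_nonpos_D4 {lam a b xh yk hh kk : ℝ} : D4.curv lam a b xh yk hh kk ≤ 0 := by
  simp only [curv]; exact le_rfl

/-- (8.13) on `D₁`: `R = |h|² - |k|² + (|k|² - (y'·k)²)(|x| + |y| - 1)/|y| ≥ 0` (Cauchy–Schwarz
`(y'·k)² ≤ |k|²`, `|k| ≤ |h|`, `|x| + |y| > 1`), so `G'' ≤ 0`. [cite: Burkholder1991, §8, (8.13)] -/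
theorem curv_nonpos_D1 {lam a b xh yk hh kk : ℝ} (hmem : D1.mem lam a b) (hk : kk ≤ hh)
    (hcs : yk ^ 2 ≤ b ^ 2 * kk) : D1.curv lam a b xh yk hh kk ≤ 0 := by
  obtain ⟨h1, h2, h3, h4⟩ := hmem
  have hb : 0 < b := by linarith
  simp only [curv]
  have hpos : 0 < 2 * burkholderAlpha * Real.exp (a + b - lam - 1) :=
    mul_pos (mul_pos two_pos burkholderAlpha_pos) (Real.exp_pos _)
  have hsq : (yk / b) ^ 2 ≤ kk := by
    rw [div_pow, div_le_iff₀ (by positivity)]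
    linarith
  have hR : 0 ≤ hh - kk + (kk - (yk / b) ^ 2) * (a + b - 1) / b := by
    have : 0 ≤ (kk - (yk / b) ^ 2) * (a + b - 1) / b :=
      div_nonneg (mul_nonneg (by linarith) (by linarith)) hb.le
    linarith
  have hA : 0 ≤ a * (xh / a + yk / b) ^ 2 := mul_nonneg h3.le (sq_nonneg _)
  have : -(a * (xh / a + yk / b) ^ 2) - (hh - kk + (kk - (yk / b) ^ 2) * (a + b - 1) / b) ≤ 0 := by
    linarith
  exact mul_nonpos_of_nonneg_of_nonpos hpos.le this

/-- (8.13) on `D₂`: `A, B, C ≥ 0` (`|x|² ≥ (λ-1-|y|)²` on `D₂` gives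
`λ - |y| - (1-|x|²)/|y| ≥ (λ-2)(λ-|y|)/|y| > 0`), so `G'' ≤ 0`. [cite: Burkholder1991, §8, (8.13)] -/
theorem curv_nonpos_D2 {lam a b xh yk hh kk : ℝ} (hlam : 2 < lam) (ha0 : 0 ≤ a)
    (hmem : D2.mem lam a b) (hk : kk ≤ hh) (hcs : yk ^ 2 ≤ b ^ 2 * kk) :
    D2.curv lam a b xh yk hh kk ≤ 0 := by
  obtain ⟨h1, h2, h3⟩ := hmem
  have hb : 0 < b := by linarith
  have hlb : 0 < lam - b := by linarith
  have hden : 0 < (lam - b) ^ 2 + 1 - a ^ 2 := den_pos_of_lt_one ha0 h3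
  have hsq : (yk / b) ^ 2 ≤ kk := by
    rw [div_pow, div_le_iff₀ (by positivity)]
    linarith
  have hx2 : (lam - 1 - b) ^ 2 ≤ a ^ 2 := by
    have : |lam - 1 - b| ≤ a := abs_le.2 ⟨by linarith, by linarith⟩
    calc (lam - 1 - b) ^ 2 = |lam - 1 - b| ^ 2 := (sq_abs _).symm
      _ ≤ a ^ 2 := pow_le_pow_left₀ (abs_nonneg _) this 2
  have hlast : 0 ≤ lam - b - (1 - a ^ 2) / b := by
    rw [sub_nonneg, div_le_iff₀ hb]
    nlinarith
  have hA : 0 ≤ (hh - kk) * (lam - b) ^ 2 * ((lam - b) ^ 2 + 1 - a ^ 2) :=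
    mul_nonneg (mul_nonneg (by linarith) (sq_nonneg _)) hden.le
  have hB : 0 ≤ (((lam - b) ^ 2 - (1 - a ^ 2)) * (yk / b) + 2 * (lam - b) * xh) ^ 2 := sq_nonneg _
  have hC : 0 ≤ (lam - b) * ((lam - b) ^ 2 + 1 - a ^ 2) * (kk - (yk / b) ^ 2)
      * (lam - b - (1 - a ^ 2) / b) :=
    mul_nonneg (mul_nonneg (mul_nonneg hlb.le hden.le) (by linarith)) hlast
  simp only [curv]
  apply div_nonpos_of_nonpos_of_nonneg
  · linarith
  · positivity

/-- (8.12): `G''(0) ≤ 0` on every region, for `|k| ≤ |h|` (with the Cauchy–Schwarz bound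
`(y·k)² ≤ |y|²|k|²`, `λ > 2`, `|x| ≥ 0`). [cite: Burkholder1991, §8, (8.12)] -/
theorem curv_nonpos {lam a b xh yk hh kk : ℝ} (hlam : 2 < lam) (ha0 : 0 ≤ a) (hk : kk ≤ hh)
    (hcs : yk ^ 2 ≤ b ^ 2 * kk) : ∀ {r : Region}, r.mem lam a b → r.curv lam a b xh yk hh kk ≤ 0
  | D0, _ => curv_nonpos_D0 hk
  | D1, h => curv_nonpos_D1 h hk hcs
  | D2, h => curv_nonpos_D2 hlam ha0 h hk hcs
  | D3, _ => curv_nonpos_D3 (by linarith) hk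
  | D4, _ => curv_nonpos_D4

end Region

end Burkholder1991

end Literature.Probability.Process

end
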